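import Mathlib
import HarnessLib
import Literature.Analysis.FluidPDE.AncientSimilarityVariables
import Literature.Analysis.FluidPDE.SpaceTimeCalculus
import Literature.Analysis.FluidPDE.PineauVicolProfileSecondTimeDerivative
import Summits.NavierStokesRegularity.NavierStokesRegularity.Theorems.QuarterLogPincerFlatWindowDefs
import Summits.NavierStokesRegularity.NavierStokesRegularity.Theorems.QuantisedSymmetryPolyhedralDssProfileExistsStubAncientMildOfClassicalTypeI
import Summits.NavierStokesRegularity.NavierStokesRegularity.Theorems.QuantisedSymmetryPolyhedralDssProfileExistsStubOrbitBounds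

/-!
# Crux `QuarterLogPincer.TypeIQuantSubcubicExp` (stmt-NavierStokesRegularity-24077), rung line `flat_window`:
  STUB (M) `stub_accelerationBound` — PROVED (Pineau–Vicol 2026, Lemma 8.1 at `α = 0`)

Lead-prover file (ns-tc-p1 g4; DIRECTOR-NS #210 (1); `--supports stmt-NavierStokesRegularity-24077
--as helper`) proving BY NAME, with its verbatim signature
`stub_accelerationBound : ∀ C₀, 0 < C₀ → ∃ B, 0 < B ∧ AccelerationBound C₀ B`, the acceleration
obligation of ns-idea-7's rung line `Cruxes/TypeIQuantSubcubicExp/Lines/flat_window.lean`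
(183c0c8f2f447a08, idea-crit-7 PASS-WITH-PRICE) over the re-homed definitions module
`Theorems/QuarterLogPincerFlatWindowDefs.lean` (`profileLine`, `AccelerationBound` verbatim).

* `profile_equation_pressurePotential` — the profile `U = lerayOrbit u` of an envelope-class classical
  ancient solution solves, on every slice, Pineau–Vicol's (1.14a) with `α = 0` and the
  Calderón–Zygmund pressure: `½U + ½DU[y] − ΔU + (U·∇)U + ∇Q[U(s)] + ∂ₛU = 0` (backward Leray system
  `isClassicalNSSolutionOn_Iio_iff_isBackwardLeraySolutionOn` + pressure identification
  `PolyhedralCell.orbitBounds_gradient_lerayOrbitPressure_eq`, Pineau–Vicol Lemma 2.1).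
* `stub_accelerationBound` — assembly: KNSS gauge automatic under Type-I decay
  (`Birth.isTypeIAncientMild_of_classical_typeI`), class-uniform (8.3) to order 6
  (`IsTypeIAncientMild.exists_forall_le_pow_mul_norm_iteratedFDeriv_lerayOrbit_of_hasTypeIDecay`),
  and the periodicity-free third display of the proof of Lemma 8.1
  (`PineauVicol2026.exists_norm_sliceDeriv2_le`, `Literature/…/PineauVicolProfileSecondTimeDerivative.lean`).
  The bound is uniform in `y` (true shape `≲ (1+|y|)⁻¹`, as the critic notes).

HONEST FRAMING: an obligation of a RUNG line on the DSS wall (near-one window); the line does not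
conclude the crux; `TypeIQuantSubcubicExp`, `SuperlogCubeRate` and Navier–Stokes regularity remain OPEN;
no summit statement is proved by this file.
-/

noncomputable section

-- the summit-side namespace `Summit.NavierStokesRegularity.NavierStokesRegularity.…` (single-conjunct summit,
-- D-0017) repeats a component by design; the dupNamespace linter would flag every declaration.
set_option linter.dupNamespace false

namespace Summit.NavierStokesRegularity.NavierStokesRegularity.Cruxes.TypeIQuantSubcubicExp.FlatWindow

open MeasureTheory Set Function Filter Topology Metric
open scoped Laplacian ContDiff
open Literature.Analysis Literature.Analysis.FluidPDE
open Summit.NavierStokesRegularity.NavierStokesRegularity.Theorems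

/-- **The profile of an envelope-class classical ancient solution solves the (unrotated) profile
equation with the Calderón–Zygmund pressure**, in the shape of Pineau–Vicol (1.14a) with `α = 0`:
`½U + ½DU[y] − ΔU + (U·∇)U + ∇Q[U(s)] + ∂ₛU = 0` on every slice, where `U = lerayOrbit u` and
`∂ₛU(s,y) = deriv (U · y) s`.  The backward Leray system for `(U, lerayOrbitPressure p)`
(`isClassicalNSSolutionOn_Iio_iff_isBackwardLeraySolutionOn`) with the pressure gradient identified
as `∇Q[U(s)]` (`PolyhedralCell.orbitBounds_gradient_lerayOrbitPressure_eq`, Pineau–Vicol Lemma 2.1).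
[folklore] -/
theorem profile_equation_pressurePotential {C₀ : ℝ}
    {u : ℝ → EuclideanSpace ℝ (Fin 3) → EuclideanSpace ℝ (Fin 3)}
    {p : ℝ → EuclideanSpace ℝ (Fin 3) → ℝ} (hcl : IsClassicalNSSolutionOn (Iio 0) 1 0 u p)
    (hI : HasTypeIDecay C₀ u) (σ : ℝ) (y : EuclideanSpace ℝ (Fin 3)) :
    (0 : ℝ) • (rotGen (lerayOrbit u σ y) - fderiv ℝ (lerayOrbit u σ) y (rotGen y))
      + (1 / 2 : ℝ) • lerayOrbit u σ y + (1 / 2 : ℝ) • fderiv ℝ (lerayOrbit u σ) y y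
      - (Δ (lerayOrbit u σ)) y + convect (lerayOrbit u σ) (lerayOrbit u σ) y
      + gradient (pressurePotential (lerayOrbit u σ)) y
      + (fun σ y => deriv (fun τ => lerayOrbit u τ y) σ) σ y = 0 := by
  have hL := isClassicalNSSolutionOn_Iio_iff_isBackwardLeraySolutionOn.1 hcl
  have hm := hL.momentum_leray (mem_univ σ) y
  rw [timeDerivWithin_apply, derivWithin_univ, one_smul,
    PolyhedralDssProfileExists.PolyhedralCell.orbitBounds_gradient_lerayOrbitPressure_eq hcl hI σ y] at hm
  rw [zero_smul, zero_add, ← hm]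
  abel

/-- **STUB (M) `stub_accelerationBound` of LINE `flat_window` — PROVED (signature verbatim;
Pineau–Vicol 2026 Lemma 8.1 at `α = 0`).**  For every envelope constant `C₀ > 0` there is
`B = B(C₀) > 0` such that every classical ancient solution `(u,p)` on `(−∞,0) × ℝ³` in the Type-I
envelope class `HasTypeIDecay C₀ u` has a `C²`-in-`s` profile line `s ↦ U(s,y)`, `U = lerayOrbit u`,
with `‖∂ₛ²U(s,y)‖ ≤ B` for all `s, y`.  Assembly: the KNSS gauge is automatic
(`isTypeIAncientMild_of_classical_typeI`); the class obeys (8.3) to order `6` with ONE constant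
`K(C₀)` (`exists_forall_le_pow_mul_norm_iteratedFDeriv_lerayOrbit_of_hasTypeIDecay 6 C₀`); the profile
solves (1.14a) with `α = 0` and the Calderón–Zygmund pressure (`profile_equation_pressurePotential`);
the periodicity-free third display of the proof of Lemma 8.1
(`PineauVicol2026.exists_norm_sliceDeriv2_le`, landed for this purpose) bounds `∂ₛ²U` by
`C_a(K)(1+|0|)²/(1+‖y‖) ≤ C_a(K)`; `B := C_a(K) + 1`.  `iteratedDeriv 2` is `∂ₛ∂ₛ`
(`iteratedDeriv_succ`, `iteratedDeriv_one`). [folklore] -/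
theorem stub_accelerationBound : ∀ C₀ : ℝ, 0 < C₀ → ∃ B : ℝ, 0 < B ∧ AccelerationBound C₀ B := by
  intro C₀ _hC₀
  obtain ⟨K, -, hK⟩ :=
    IsTypeIAncientMild.exists_forall_le_pow_mul_norm_iteratedFDeriv_lerayOrbit_of_hasTypeIDecay 6 C₀
  obtain ⟨Ca, hCa0, hCa⟩ := PineauVicol2026.exists_norm_sliceDeriv2_le K
  refine ⟨Ca + 1, by positivity, ?_⟩
  intro u p hcl hI y
  have hA : IsTypeIAncientMild C₀ u :=
    PolyhedralDssProfileExists.Birth.isTypeIAncientMild_of_classical_typeI hcl hI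
  have hL := isClassicalNSSolutionOn_Iio_iff_isBackwardLeraySolutionOn.1 hcl
  have hU : IsSmoothSpaceTimeOn Set.univ (lerayOrbit u) := hL.smooth_velocity
  have h83 : ∀ σ, ∀ j ≤ 6, ∀ y, (1 + ‖y‖) ^ (j + 1) * ‖iteratedFDeriv ℝ j (lerayOrbit u σ) y‖ ≤ K :=
    fun σ j hj y => hK hA hI σ j hj y
  have hW := hCa (lerayOrbit u) (fun σ y => deriv (fun τ => lerayOrbit u τ y) σ)
    (fun σ y => deriv (fun τ => (fun σ y => deriv (fun τ => lerayOrbit u τ y) σ) τ y) σ) 0 hU rfl rfl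
    h83 (profile_equation_pressurePotential hcl hI)
  -- the profile line is smooth
  have hline : ContDiff ℝ ∞ (profileLine u y) := by
    have hc : ContDiff ℝ ∞ (fun s : ℝ => ((s, y) : ℝ × EuclideanSpace ℝ (Fin 3))) :=
      contDiff_id.prodMk contDiff_const
    exact hU.comp_contDiff hc (fun s => mk_mem_prod (mem_univ s) (mem_univ y))
  refine ⟨hline.of_le (by norm_cast), fun s => ?_⟩
  have hid : iteratedDeriv 2 (profileLine u y) s =
      deriv (fun τ => deriv (fun τ' => lerayOrbit u τ' y) τ) s := by
    rw [iteratedDeriv_succ, iteratedDeriv_one]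
    rfl
  rw [hid]
  have h := hW s y
  simp only [abs_zero, add_zero, one_pow, mul_one] at h
  have h1 : Ca / (1 + ‖y‖) ≤ Ca := div_le_self hCa0 (by linarith [norm_nonneg y])
  linarith

end Summit.NavierStokesRegularity.NavierStokesRegularity.Cruxes.TypeIQuantSubcubicExp.FlatWindow

end
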